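import Literature.Probability.RandomPlanarGeometry.SAWWordBridges
import Literature.Probability.RandomPlanarGeometry.SAWCount

/-!
# Crux-ideate sketch — `ConfinementPositivity` (stmt-CriticalPhenomena-17587), ideator 2, round 1

Idea `sign-universality` (card `Ideas/sign-universality.md`).  Typed objects of the line:

* `irrMass p` — the Kesten-measure probability of a property `p` of an irreducible bridge word
  (`∑' x_c^{|w|}` over irreducible bridges with `p w`; a probability by `KestenIdentity_proof`);
* `yEnd`, `yExtent` — height increment and vertical extent of a word;
* the two ONE-PIECE shape primitives of Kesten's measure the line bets on:
  `UniformAspectTightness` (UAT: extent ≲ span, conditional tail `≤ C/t`) and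
  `HeightAnticoncentration` (AR: the conditional height law given span `s` has atoms `≤ C/s`);
* the bridge-position core of the crux in lattice units, `SlabTubeConfinement` (pinned walks from
  `(0,0)` to `(L,0)` inside the slab `0 ≤ x ≤ L`: the `x_c`-mass confined to `|y| ≤ W` is `≥ c(α)`
  times the mass confined to `|y| ≤ V`, any `V ≥ W`, whenever `L ≤ α W`);
* FIRST LEMMA (provable now, pure combinatorics of sign flips): `rademacherTube` — the universal
  small-ball lower bound for ± walks with prescribed step sizes;
* the line's core claim `slabTube_of_UAT_AR` (sorried: this is the bet, not a theorem).
-/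

noncomputable section
open scoped BigOperators
open Classical
open Literature.Probability.RandomPlanarGeometry Literature.Probability.RandomPlanarGeometry.SAW
open Literature.Probability.LatticeModels

namespace Summit.CriticalPhenomena.SAWScalingLimit.Cruxes.ConfinementPositivity.SignUniversality

/-! ### Kesten's measure on irreducible bridges, as masses of properties -/

/-- `P_K(p)`: the critical mass `∑ x_c^{|w|}` of irreducible bridge words satisfying `p`
(a probability measure on words by Kesten's identity `∑_irr x_c^{|w|} = 1`, `KestenIdentity_proof`). -/
def irrMass (p : List Step → Prop) : ℝ :=
  ∑' w : {w : List Step // IsIrrBridge w}, if p w.1 then criticalFugacity ^ w.1.length else 0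

/-- Height (second coordinate) after `i` steps. -/
def yAt (w : List Step) (i : ℕ) : ℤ := traj w i 1

/-- Height increment `H(w)` of the word. -/
def yEnd (w : List Step) : ℤ := wEnd w 1

/-- Vertical extent `E(w) = max_i |y_i|` of the word (relative to its start). -/
def yExtent (w : List Step) : ℕ :=
  (Finset.range (w.length + 1)).sup fun i => (yAt w i).natAbs

/-! ### The two one-piece shape primitives (OPEN; the line's honest residual inputs) -/

/-- **UAT** (uniform aspect tightness of one irreducible bridge): the conditional tail of the
vertical extent given the span `s` is `≤ C/t` at `t` spans, uniformly in `s`. -/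
def UniformAspectTightness : Prop :=
  ∃ C : ℝ, 0 < C ∧ ∀ s t : ℕ, 1 ≤ s → 1 ≤ t →
    irrMass (fun w => xEnd w = s ∧ t * s ≤ yExtent w) ≤ C / t * irrMass (fun w => xEnd w = s)

/-- **AR** (height anti-concentration of one irreducible bridge): given the span `s`, no single
height value carries more than `C/s` of the conditional mass. -/
def HeightAnticoncentration : Prop :=
  ∃ C : ℝ, 0 < C ∧ ∀ s : ℕ, 1 ≤ s → ∀ h : ℤ,
    irrMass (fun w => xEnd w = s ∧ yEnd w = h) ≤ C / s * irrMass (fun w => xEnd w = s)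

/-! ### The bridge-position core of the crux, lattice units -/

/-- Partial `x_c`-mass (lengths `≤ N`) of SAWs from `(0, y₀)` to `(L, y₁)` (as vertex functions from
the origin, translated) staying in the box `0 ≤ x ≤ L`, `|y| ≤ W`: every such walk is a weak `x`-bridge
of span `L` — bridge-ness comes from the slab, not from the tube. -/
def slabTubeMass (L W : ℕ) (y₀ y₁ : ℤ) (N : ℕ) : ℝ :=
  ∑ n ∈ Finset.range (N + 1),
    ∑ _ω ∈ (Zd.sawFun 2 n ![(L : ℤ), y₁ - y₀]).filter
        (fun ω => ∀ i ≤ n, (0 : ℤ) ≤ ω i 0 ∧ ω i 0 ≤ (L : ℤ) ∧ |y₀ + ω i 1| ≤ (W : ℤ)),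
      criticalFugacity ^ n

/-- **Slab tube confinement** (pinned at both ends, bridge position): at aspect `≤ α` the thin tube
`|y| ≤ W` keeps a fraction `c(α) > 0` of the mass of any fatter tube `|y| ≤ V` with the same pinned
endpoints `(0, y₀)`, `(L, y₁)`, `|y₀|, |y₁| ≤ W/2` (entry/exit heights are arbitrary in the central half:
this is the form the renewal-gap product formula consumes). -/
def SlabTubeConfinement : Prop :=
  ∀ α : ℕ, 1 ≤ α → ∃ c : ℝ, 0 < c ∧ ∀ (L W V : ℕ) (y₀ y₁ : ℤ), 1 ≤ W → W ≤ V → L ≤ α * W →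
    2 * |y₀| ≤ (W : ℤ) → 2 * |y₁| ≤ (W : ℤ) →
    ∀ N : ℕ, ∃ N' : ℕ, c * slabTubeMass L V y₀ y₁ N ≤ slabTubeMass L W y₀ y₁ N'

/-- **No-straddle / span regularity (SR)** — the mild span-law input under which a renewal of Kesten's
chain falls in every window `[u, 2u]` with probability `≥ c`: the chain started at `0` has a renewal point
with first coordinate in `[u, 2u]`.  (Fails only for slowly-varying span tails; much weaker than any
power law.)  Stated on words: the Kesten mass of finite chains `w₁ ⋯ w_k` (each `wᵢ` irreducible) whose
total span lands in `[u, 2u]`, counted once via the FIRST such `k`, is `≥ c`. -/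
def SpanNoStraddle : Prop :=
  ∃ c : ℝ, 0 < c ∧ ∀ u : ℕ, 1 ≤ u →
    c ≤ ∑' l : {l : List (List Step) // (∀ w ∈ l, IsIrrBridge w) ∧
          (u : ℤ) ≤ (l.map xEnd).sum ∧ (l.map xEnd).sum ≤ 2 * u ∧
          ∀ l' : List (List Step), l' <+: l → l' ≠ l → (l'.map xEnd).sum < u},
      criticalFugacity ^ (l.1.map List.length).sum

/-! ### FIRST LEMMA (provable now): the universal small-ball bound for sign-flip walks -/

/-- Signed partial sum `S_k(σ) = ∑_{i<k} ±h_i` of the first `k` prescribed steps. -/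
def signedPartialSum {n : ℕ} (h : Fin n → ℕ) (σ : Fin n → Bool) (k : ℕ) : ℤ :=
  ∑ i : Fin n, if (i : ℕ) < k then (if σ i then (h i : ℤ) else -(h i : ℤ)) else 0

/-- **Universal Rademacher tube lemma** (distribution-free; Kolmogorov's maximal inequality on
variance blocks + a symmetry chaining): for ANY step sizes `h_i ≤ r/2` with `∑ h_i² ≤ K r²`, at
least a fraction `C^{-(K+1)}` of the `2ⁿ` sign patterns keeps every partial sum in `[-r, r]`.
This is the engine that makes tube confinement of Kesten's chain distribution-free once the signs
of the pieces are isolated (`flipWord`). -/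
theorem rademacherTube : ∃ C : ℕ, 0 < C ∧ ∀ (n r K : ℕ) (h : Fin n → ℕ), 1 ≤ r →
    (∀ i, 2 * h i ≤ r) → (∑ i, h i ^ 2) ≤ K * r ^ 2 →
      2 ^ n ≤ C ^ (K + 1) *
        ((Finset.univ : Finset (Fin n → Bool)).filter
          (fun σ => ∀ k ≤ n, |signedPartialSum h σ k| ≤ r)).card := by
  sorry

/-- Dual engine (also distribution-free; Paley–Zygmund + Khintchine on variance blocks): a sign-flip
walk whose steps accumulate variance `≥ K r²` stays in `[-r, r]` with probability `≤ C^{-K}` —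
the device that turns LOWER aspect tightness of the pieces into the strip decay rate `W·m_W ≥ c`. -/
theorem rademacherAntiTube : ∃ C : ℕ, 1 < C ∧ ∀ (n r K : ℕ) (h : Fin n → ℕ), 1 ≤ r →
    (∀ i, h i ≤ r) → K * r ^ 2 ≤ (∑ i, h i ^ 2) →
      C ^ K * ((Finset.univ : Finset (Fin n → Bool)).filter
          (fun σ => ∀ k ≤ n, |signedPartialSum h σ k| ≤ r)).card ≤ 2 ^ n := by
  sorry

/-! ### The line's core claim (the bet; NOT a theorem today) -/

/-- Sign-conditioning of Kesten's i.i.d. chain (`KestenIdentity_proof`, `flipWord`, unique decoding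
`eq_of_append_eq`) + `rademacherTube` for the unpinned part + AR (through exponential tilting and a
central local limit lower bound) for the pinning ⟹ the bridge-position core of the crux from the
two one-piece primitives. -/
theorem slabTube_of_UAT_AR :
    UniformAspectTightness → HeightAnticoncentration → SlabTubeConfinement := by
  sorry

/- The crux decl this line ultimately serves (by name):
   `Summit.CriticalPhenomena.SAWScalingLimit.Theses.SAWRenewalTightness.ConfinementPositivity`
   (not imported here: the route olean is stale on the farm at filing time). -/

end Summit.CriticalPhenomena.SAWScalingLimit.Cruxes.ConfinementPositivity.SignUniversality
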